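import Literature.AlgebraicGeometry.GroupSchemes.BirationalGroupLawTransport
import Mathlib.AlgebraicGeometry.Birational.RationalMap
import HarnessLib

/-!
# Weil's gluing step, the law on `V′ = V ∪ V_s` (I): charts as restrictions of ONE rational map
# (Artin, *Néron models*, §2, Lemma 2.4)

Topic `Literature/AlgebraicGeometry/GroupSchemes`, namespace `Literature.AlgebraicGeometry.GroupSchemes`.
KERNEL ONLY: theorems; no definition, no named fact, no instance, no `sorry`.  Cell `hodgecm-mathlib` (D-0151),
road W (Néron capital), piece (G2b) of the W1c design (`A-provers/A-p06/W1c-DESIGN.A-p06g5.md`).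

In Artin's step ([Artin1986NeronModels] §2, Lemma 2.4) the glued scheme `V′ = V ∪_{W_s} V_s` has two charts
`i₁, i₂ : 𝒱 → 𝒲` (open immersions over `S`, `ρ ≫ i₁ = ι_A ≫ i₂` where `ρ : A → 𝒱`, `a ↦ a·s`, is the right
translate by the section `s`, tree `BirationalGroupLawTranslate` / `WeilGluingStep`), and the birational law of
`𝒱` is to be extended to `𝒲`.  We realise every chart of the extended law as a `Scheme.PartialMap` on `𝒲 ×_S 𝒲`
(Mathlib `AlgebraicGeometry.Birational.RationalMap`) and prove the charts EQUIVALENT (equal on a dense open), so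
that all of them are restrictions of the canonical extension `RationalMap.toPartialMap` of one rational map
`𝒲 ×_S 𝒲 ⤏ 𝒲` — this is how the law on `V′` is well defined without any explicit gluing of morphisms.

* §0 generalities: `isOpenImmersion_tensorHom_left'` and the coordinates of `f ⊗ g` for `S`-morphisms with
  different sources; `dense_opensRange_of_irreducibleSpace`; **`PartialMap.equiv_of_isOpenImmersion`** — two partial maps on an irreducible
  scheme which agree after composition with ONE open immersion from a non-empty scheme (landing in both domains)
  are equivalent.
* §1 **`chart₁₂_equiv_chart₁₁`** — the chart «`(i₁ x, i₂ b) ↦ i₂(x b)`» on `(i₁ ⊗ i₂)(dom)` is equivalent to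
  the base chart «`(i₁ x, i₁ y) ↦ i₁(x y)`» on `(i₁ ⊗ i₁)(dom)`: at the points `(i₁ x, i₂ b) = (i₁ x, i₁(b s))`
  with `b s`, `x b`, `(x b) s`, `x (b s)` defined, `i₂(x b) = i₁((x b) s) = i₁(x (b s))` ([Artin1986NeronModels]
  Lemma 2.4; the witnesses live on the open `Ω ⊆ 𝒱 ×_S A`, non-empty because `𝒱 ×_S 𝒱` is irreducible).
  The section enters only through a slice embedding `σ = (𝟙, s∘π)` given by its two coordinates and a lift
  `eρ : A → dom` of `ι_A ≫ σ` with `ρ = eρ ≫ mul` (the shape of ★ `BirationalGroupLaw.exists_rightTranslate`).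

The companion file treats the chart «`(i₂ a, i₁ x) ↦ i₁(a (s x))`» (Artin's «`(a′, x) ↦ (a′, a y)`, `x = s⁻¹y`»).
[Artin1986NeronModels] M. Artin, *Néron models*, in Cornell–Silverman, *Arithmetic Geometry* (1986), §2, Lemma 2.4,
p. 222 (held: `book:cornellnd-arithmetic-geometry` p0293); [EdixhovenRomagny] Def. 3.4 (held).
HC_CM is not proved here; nothing here changes the floor.

## References
* [Artin1986NeronModels] M. Artin, *Néron models*, in *Arithmetic Geometry* (Cornell, Silverman eds.), Springer 1986, §2.
* [EdixhovenRomagny] B. Edixhoven, M. Romagny, *Group schemes out of birational group laws, Néron models*, Panor. Synthèses 47 (2015), §3.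
-/

noncomputable section

namespace Literature.AlgebraicGeometry.GroupSchemes

open CategoryTheory CategoryTheory.Limits _root_.AlgebraicGeometry MonoidalCategory CartesianMonoidalCategory
  TopologicalSpace
open scoped CategoryTheory.Obj

universe u

/-! ## §0. Generalities: products of open immersions, dense ranges, equivalence of partial maps along an open immersion -/

section General

variable {S : Scheme.{u}} in
/-- The product over `S` of two open immersions (between possibly different `S`-schemes) is an open immersion.
[cite: Artin1986NeronModels, §2 Lemma 2.4 p. 222] -/
theorem isOpenImmersion_tensorHom_left' {X₁ X₂ Y₁ Y₂ : Over S} (f : X₁ ⟶ Y₁) (g : X₂ ⟶ Y₂)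
    [IsOpenImmersion f.left] [IsOpenImmersion g.left] : IsOpenImmersion (f ⊗ₘ g).left := by
  rw [Over.tensorHom_left]
  exact Scheme.pullback_map_isOpenImmersion _ _ _ _ _ _ _ _ _

variable {S : Scheme.{u}} in
/-- First coordinate of `f ⊗ g` (general sources and targets). [cite: Artin1986NeronModels, §2 Lemma 2.4 p. 222] -/
theorem tensorHom_left_fst_left' {X₁ X₂ Y₁ Y₂ : Over S} (f : X₁ ⟶ Y₁) (g : X₂ ⟶ Y₂) :
    (f ⊗ₘ g).left ≫ (fst Y₁ Y₂).left = (fst X₁ X₂).left ≫ f.left :=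
  congrArg CommaMorphism.left (tensorHom_fst f g)

variable {S : Scheme.{u}} in
/-- Second coordinate of `f ⊗ g` (general sources and targets). [cite: Artin1986NeronModels, §2 Lemma 2.4 p. 222] -/
theorem tensorHom_left_snd_left' {X₁ X₂ Y₁ Y₂ : Over S} (f : X₁ ⟶ Y₁) (g : X₂ ⟶ Y₂) :
    (f ⊗ₘ g).left ≫ (snd Y₁ Y₂).left = (snd X₁ X₂).left ≫ g.left :=
  congrArg CommaMorphism.left (tensorHom_snd f g)

/-- An open immersion from a non-empty scheme into an irreducible scheme has dense range («`V` is dense in `V′`»).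
[cite: Artin1986NeronModels, §2 Lemma 2.4 p. 222] -/
theorem dense_opensRange_of_irreducibleSpace {X Y : Scheme.{u}} (f : X ⟶ Y) [IsOpenImmersion f]
    [IrreducibleSpace Y] [Nonempty X] : Dense (f.opensRange : Set Y) :=
  f.isOpenEmbedding.isOpen_range.dense ⟨f.base (Classical.arbitrary X), Classical.arbitrary X, rfl⟩

/-- **Two partial maps agreeing along an open immersion from a non-empty scheme are equivalent** (source
irreducible, so that the range is dense): the device by which all charts of the law on `V′` are restrictions of one
rational map. [cite: Artin1986NeronModels, §2 Lemma 2.4 p. 222] -/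
theorem PartialMap.equiv_of_isOpenImmersion {X Y Q : Scheme.{u}} [IrreducibleSpace X] [Nonempty Q]
    (c c' : X.PartialMap Y) (w : Q ⟶ X) [IsOpenImmersion w]
    (l : Q ⟶ (c.domain : Scheme.{u})) (hl : l ≫ c.domain.ι = w)
    (l' : Q ⟶ (c'.domain : Scheme.{u})) (hl' : l' ≫ c'.domain.ι = w)
    (h : l ≫ c.hom = l' ≫ c'.hom) : c.equiv c' := by
  have hle : w.opensRange ≤ c.domain := by
    intro x hx
    obtain ⟨q, rfl⟩ := hx
    have : (l ≫ c.domain.ι).base q ∈ Set.range c.domain.ι.base := ⟨l.base q, rfl⟩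
    rw [hl, Scheme.Opens.range_ι] at this
    exact this
  have hle' : w.opensRange ≤ c'.domain := by
    intro x hx
    obtain ⟨q, rfl⟩ := hx
    have : (l' ≫ c'.domain.ι).base q ∈ Set.range c'.domain.ι.base := ⟨l'.base q, rfl⟩
    rw [hl', Scheme.Opens.range_ι] at this
    exact this
  refine ⟨w.opensRange, dense_opensRange_of_irreducibleSpace w, hle, hle', ?_⟩
  show (X.homOfLE hle ≫ c.hom : (w.opensRange : Scheme.{u}) ⟶ Y) = X.homOfLE hle' ≫ c'.hom
  rw [← cancel_epi w.isoOpensRange.hom]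
  have e1 : w.isoOpensRange.hom ≫ X.homOfLE hle = l := by
    rw [← cancel_mono c.domain.ι, Category.assoc, Scheme.homOfLE_ι, Scheme.Hom.isoOpensRange_hom_ι, hl]
  have e2 : w.isoOpensRange.hom ≫ X.homOfLE hle' = l' := by
    rw [← cancel_mono c'.domain.ι, Category.assoc, Scheme.homOfLE_ι, Scheme.Hom.isoOpensRange_hom_ι, hl']
  rw [reassoc_of% e1, reassoc_of% e2, h]

end General

/-! ## §1. The right-translate gluing: the chart `(i₁ ⊗ i₂)(dom) ↦ i₂ ∘ mul` («`x·(b s) = (x b)·s`») is a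
restriction of the rational map of the chart `(i₁ ⊗ i₁)(dom) ↦ i₁ ∘ mul` -/

section Chart12

variable {S : Scheme.{u}} {𝒱 𝒲 : Over S} (L : BirationalGroupLaw 𝒱)
  (i₁ i₂ : 𝒱 ⟶ 𝒲) [IsOpenImmersion i₁.left] [IsOpenImmersion i₂.left]
  [IsOpenImmersion (i₁ ⊗ₘ i₁).left] [IsOpenImmersion (i₁ ⊗ₘ i₂).left]
  (s : S ⟶ 𝒱.left) (σ : 𝒱.left ⟶ (𝒱 ⊗ 𝒱).left) (hσ₁ : σ ≫ (fst 𝒱 𝒱).left = 𝟙 _)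
  (hσ₂ : σ ≫ (snd 𝒱 𝒱).left = 𝒱.hom ≫ s)
  (A : 𝒱.left.Opens) (eρ : (A : Scheme.{u}) ⟶ (L.dom : Scheme.{u})) (heρ : eρ ≫ L.dom.ι = A.ι ≫ σ)
  (hρo : IsOpenImmersion (eρ ≫ L.mul)) (hglue : (eρ ≫ L.mul) ≫ i₁.left = A.ι ≫ i₂.left)

/-- `dom` is non-empty as soon as `𝒱 ×_S 𝒱` is irreducible (it is dense). [cite: EdixhovenRomagny, Def. 3.4 (1)] -/
private theorem nonempty_dom [IrreducibleSpace ↑(𝒱 ⊗ 𝒱).left] : Nonempty (L.dom : Scheme.{u}) := by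
  obtain ⟨z, hz⟩ := L.dense_dom.dense.nonempty
  exact ⟨⟨z, hz⟩⟩

include hσ₁ heρ in
/-- The right translate `ρ = eρ ≫ mul : A → 𝒱` is a morphism over `S`. [cite: Artin1986NeronModels, §2 p. 222] -/
private theorem rho_comp_hom : (eρ ≫ L.mul) ≫ 𝒱.hom = A.ι ≫ 𝒱.hom := by
  rw [Category.assoc, L.mul_comp, ← Category.assoc, heρ, Category.assoc, ← Over.w (fst 𝒱 𝒱),
    ← Category.assoc σ, hσ₁, Category.id_comp]

include s σ hσ₁ hσ₂ eρ heρ hρo hglue in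
omit [IsOpenImmersion i₁.left] [IsOpenImmersion i₂.left] in
/-- **Artin's Lemma 2.4, the easy chart**: in the glued scheme `V′ = V ∪_{W_s} V_s` (`i₁, i₂ : 𝒱 → 𝒲` the two
charts, `ρ ≫ i₁ = ι_A ≫ i₂`, `ρ = (· s)` the right translate), the partial map «`(i₁ x, i₂ b) ↦ i₂(x b)`» on
`(i₁ ⊗ i₂)(dom)` is EQUIVALENT (agrees on a dense open) to the partial map «`(i₁ x, i₁ y) ↦ i₁(x y)`» on
`(i₁ ⊗ i₁)(dom)`: on the dense open of points `(i₁ x, i₂ b) = (i₁ x, i₁(b s))` with `b s`, `x b`, `(x b) s`,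
`x (b s)` all defined, `i₂(x b) = i₁((x b) s) = i₁(x (b s))` by associativity.  Hence both are restrictions of
ONE rational map `𝒲 ×_S 𝒲 ⤏ 𝒲` (Mathlib `Scheme.PartialMap.toRationalMap_eq_iff`).
[cite: Artin1986NeronModels, §2 Lemma 2.4 p. 222] [cite: EdixhovenRomagny, Def. 3.4 (3)] -/
theorem chart₁₂_equiv_chart₁₁ [IrreducibleSpace ↑(𝒱 ⊗ 𝒱).left] [IrreducibleSpace ↑(𝒲 ⊗ 𝒲).left]
    (hA : (A : Set 𝒱.left).Nonempty) :
    (⟨(L.dom.ι ≫ (i₁ ⊗ₘ i₂).left).opensRange,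
        haveI := nonempty_dom L; dense_opensRange_of_irreducibleSpace _,
        (L.dom.ι ≫ (i₁ ⊗ₘ i₂).left).isoOpensRange.inv ≫ L.mul ≫ i₂.left⟩ :
        (𝒲 ⊗ 𝒲).left.PartialMap 𝒲.left).equiv
      ⟨(L.dom.ι ≫ (i₁ ⊗ₘ i₁).left).opensRange,
        haveI := nonempty_dom L; dense_opensRange_of_irreducibleSpace _,
        (L.dom.ι ≫ (i₁ ⊗ₘ i₁).left).isoOpensRange.inv ≫ L.mul ≫ i₁.left⟩ := by
  haveI := nonempty_dom L
  haveI hΨo := L.isOpenImmersion_shearRight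
  haveI := hρo
  have hρS : (eρ ≫ L.mul) ≫ 𝒱.hom = A.ι ≫ 𝒱.hom := rho_comp_hom (L := L) (hσ₁ := hσ₁) (heρ := heρ)
  have hirrVV : IsPreirreducible (Set.univ : Set ↑(𝒱 ⊗ 𝒱).left) := PreirreducibleSpace.isPreirreducible_univ
  -- the `S`-scheme `A`, the translate `ρ` and the inclusion as `S`-morphisms; the parameter scheme `P = 𝒱 ×_S A`
  let AO : Over S := Over.mk (A.ι ≫ 𝒱.hom)
  let ιO : AO ⟶ 𝒱 := Over.homMk A.ι rfl
  let ρO : AO ⟶ 𝒱 := Over.homMk (eρ ≫ L.mul) hρS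
  haveI : IsOpenImmersion ιO.left := inferInstanceAs (IsOpenImmersion A.ι)
  haveI : IsOpenImmersion ρO.left := inferInstanceAs (IsOpenImmersion (eρ ≫ L.mul))
  haveI : IsOpenImmersion (𝟙 𝒱 : 𝒱 ⟶ 𝒱).left := by change IsOpenImmersion (𝟙 𝒱.left); infer_instance
  let P : Scheme.{u} := (𝒱 ⊗ AO).left
  let θ' : P ⟶ (𝒱 ⊗ 𝒱).left := (𝟙 𝒱 ⊗ₘ ιO).left
  let θ : P ⟶ (𝒱 ⊗ 𝒱).left := (𝟙 𝒱 ⊗ₘ ρO).left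
  haveI hθ'o : IsOpenImmersion θ' := isOpenImmersion_tensorHom_left' (𝟙 𝒱) ιO
  haveI hθo : IsOpenImmersion θ := isOpenImmersion_tensorHom_left' (𝟙 𝒱) ρO
  have hθ'1 : θ' ≫ (fst 𝒱 𝒱).left = (fst 𝒱 AO).left := by
    change (𝟙 𝒱 ⊗ₘ ιO).left ≫ (fst 𝒱 𝒱).left = _
    rw [tensorHom_left_fst_left']; exact Category.comp_id _
  -- the second projection of `P`, typed with target `↑A` (so that compositions with `eρ`, `A.ι` rewrite smoothly)
  let πA : P ⟶ (A : Scheme.{u}) := (snd 𝒱 AO).left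
  have hθ'2 : θ' ≫ (snd 𝒱 𝒱).left = πA ≫ A.ι := tensorHom_left_snd_left' (𝟙 𝒱) ιO
  have hθ1 : θ ≫ (fst 𝒱 𝒱).left = (fst 𝒱 AO).left := by
    change (𝟙 𝒱 ⊗ₘ ρO).left ≫ (fst 𝒱 𝒱).left = _
    rw [tensorHom_left_fst_left']; exact Category.comp_id _
  have hθ2 : θ ≫ (snd 𝒱 𝒱).left = πA ≫ eρ ≫ L.mul := tensorHom_left_snd_left' (𝟙 𝒱) ρO
  -- a point `a₀` of `A` and a point of `P`
  obtain ⟨a₀, ha₀⟩ := hA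
  have ha₀' : a₀ ∈ Set.range A.ι.base := by rw [Scheme.Opens.range_ι]; exact ha₀
  obtain ⟨a₁, ha₁⟩ := ha₀'
  haveI : Nonempty P := by
    obtain ⟨z, -, -⟩ := Scheme.Pullback.exists_preimage_pullback (f := 𝒱.hom) (g := AO.hom) a₀ a₁
      (by change 𝒱.hom.base a₀ = (A.ι ≫ 𝒱.hom).base a₁; rw [Scheme.Hom.comp_base, TopCat.coe_comp,
        Function.comp_apply, ha₁])
    exact ⟨z⟩
  haveI hP : IrreducibleSpace P := θ'.isOpenEmbedding.irreducibleSpace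
  -- the good open `Ω ⊆ P`
  let U₂ : (𝒱 ⊗ 𝒱).left.Opens := L.dom.ι ''ᵁ (L.mul ⁻¹ᵁ A)
  let Ω : P.Opens := θ' ⁻¹ᵁ L.dom ⊓ θ ⁻¹ᵁ L.dom ⊓ θ' ⁻¹ᵁ U₂
  -- non-emptiness of `Ω`
  have hdomne : ((L.dom : Set ↑(𝒱 ⊗ 𝒱).left)).Nonempty := L.dense_dom.dense.nonempty
  have meet : ∀ (U V : (𝒱 ⊗ 𝒱).left.Opens), (U : Set ↑(𝒱 ⊗ 𝒱).left).Nonempty →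
      (V : Set ↑(𝒱 ⊗ 𝒱).left).Nonempty → ((U : Set ↑(𝒱 ⊗ 𝒱).left) ∩ V).Nonempty := fun U V hU hV =>
    nonempty_preirreducible_inter U.2 V.2 hU hV
  have hN : ∀ (g : P ⟶ (𝒱 ⊗ 𝒱).left) [IsOpenImmersion g] (V : (𝒱 ⊗ 𝒱).left.Opens),
      (V : Set ↑(𝒱 ⊗ 𝒱).left).Nonempty → ((g ⁻¹ᵁ V : P.Opens) : Set P).Nonempty := by
    intro g _ V hV
    obtain ⟨_, ⟨p, rfl⟩, hp⟩ := meet g.opensRange V ⟨_, Classical.arbitrary P, rfl⟩ hV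
    exact ⟨p, hp⟩
  have hU₂ : (U₂ : Set ↑(𝒱 ⊗ 𝒱).left).Nonempty := by
    -- `im Ψ ∩ pr₁⁻¹ A ≠ ∅`
    obtain ⟨w₀, hw₀, -⟩ := Scheme.Pullback.exists_preimage_pullback (f := 𝒱.hom) (g := 𝒱.hom) a₀ a₀ rfl
    obtain ⟨d₀, hd₀⟩ := hdomne
    obtain ⟨_, ⟨z, rfl⟩, hz⟩ := meet L.shearRight.left.opensRange ((fst 𝒱 𝒱).left ⁻¹ᵁ A)
      ⟨_, ⟨d₀, hd₀⟩, rfl⟩ ⟨w₀, show (pullback.fst 𝒱.hom 𝒱.hom).base w₀ ∈ A by rw [hw₀]; exact ha₀⟩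
    have hz' : L.mul.base z ∈ A := by
      have : (fst 𝒱 𝒱).left.base (L.shearRight.left.base z) ∈ A := hz
      rwa [L.fst_shearRight_base] at this
    exact ⟨L.dom.ι.base z, z, hz', rfl⟩
  have hΩ : (Ω : Set P).Nonempty := by
    have h1 := hN θ' L.dom hdomne
    have h2 := hN θ L.dom hdomne
    have h3 := hN θ' U₂ hU₂
    have h12 : (((θ' ⁻¹ᵁ L.dom ⊓ θ ⁻¹ᵁ L.dom : P.Opens)) : Set P).Nonempty :=
      nonempty_preirreducible_inter (θ' ⁻¹ᵁ L.dom).2 (θ ⁻¹ᵁ L.dom).2 h1 h2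
    exact nonempty_preirreducible_inter (θ' ⁻¹ᵁ L.dom ⊓ θ ⁻¹ᵁ L.dom).2 (θ' ⁻¹ᵁ U₂).2 h12 h3
  haveI : Nonempty (Ω : Scheme.{u}) := by
    obtain ⟨p, hp⟩ := hΩ; exact ⟨⟨p, hp⟩⟩
  -- membership facts for points of `Ω`
  have memΩ : ∀ q : (Ω : Scheme.{u}), θ'.base (Ω.ι.base q) ∈ L.dom ∧ θ.base (Ω.ι.base q) ∈ L.dom ∧
      θ'.base (Ω.ι.base q) ∈ U₂ := fun q => by
    have : Ω.ι.base q ∈ Ω := by rw [← SetLike.mem_coe, ← Scheme.Opens.range_ι]; exact ⟨q, rfl⟩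
    exact ⟨this.1.1, this.1.2, this.2⟩
  -- the witnesses `p₁ = (x, b)`, `p₂ = (b, s)`, `p₃ = (xb, s)`, `p₄ = (x, bs)` as `Ω`-points of `dom`
  have r₁ : Set.range (Ω.ι ≫ θ').base ⊆ Set.range L.dom.ι.base := by
    rintro _ ⟨q, rfl⟩; rw [Scheme.Opens.range_ι]; exact (memΩ q).1
  obtain ⟨p₁, hp₁⟩ : ∃ p₁ : (Ω : Scheme.{u}) ⟶ (L.dom : Scheme.{u}), p₁ ≫ L.dom.ι = Ω.ι ≫ θ' :=
    ⟨IsOpenImmersion.lift L.dom.ι (Ω.ι ≫ θ') r₁, IsOpenImmersion.lift_fac _ _ _⟩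
  have r₃ : Set.range (p₁ ≫ L.mul).base ⊆ Set.range A.ι.base := by
    rintro _ ⟨q, rfl⟩
    rw [Scheme.Opens.range_ι]
    obtain ⟨z, hz, hz'⟩ := (memΩ q).2.2
    have e : L.dom.ι.base (p₁.base q) = L.dom.ι.base z := by
      change (p₁ ≫ L.dom.ι).base q = _
      rw [hp₁]
      exact hz'.symm
    have : p₁.base q = z := L.dom.ι.isOpenEmbedding.injective e
    change L.mul.base (p₁.base q) ∈ A
    rw [this]
    exact hz
  obtain ⟨a₃, ha₃⟩ : ∃ a₃ : (Ω : Scheme.{u}) ⟶ (A : Scheme.{u}), a₃ ≫ A.ι = p₁ ≫ L.mul :=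
    ⟨IsOpenImmersion.lift A.ι (p₁ ≫ L.mul) r₃, IsOpenImmersion.lift_fac _ _ _⟩
  have r₄ : Set.range (Ω.ι ≫ θ).base ⊆ Set.range L.dom.ι.base := by
    rintro _ ⟨q, rfl⟩; rw [Scheme.Opens.range_ι]; exact (memΩ q).2.1
  obtain ⟨p₄, hp₄⟩ : ∃ p₄ : (Ω : Scheme.{u}) ⟶ (L.dom : Scheme.{u}), p₄ ≫ L.dom.ι = Ω.ι ≫ θ :=
    ⟨IsOpenImmersion.lift L.dom.ι (Ω.ι ≫ θ) r₄, IsOpenImmersion.lift_fac _ _ _⟩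
  -- coordinate identities
  have eρ_fst : eρ ≫ L.dom.ι ≫ (fst 𝒱 𝒱).left = A.ι := by
    rw [← Category.assoc, heρ, Category.assoc, hσ₁, Category.comp_id]
  have eρ_snd : eρ ≫ L.dom.ι ≫ (snd 𝒱 𝒱).left = A.ι ≫ 𝒱.hom ≫ s := by
    rw [← Category.assoc, heρ, Category.assoc, hσ₂]
  have mul_hom : L.mul ≫ 𝒱.hom = L.dom.ι ≫ (snd 𝒱 𝒱).left ≫ 𝒱.hom := by
    rw [L.mul_comp, Over.w (snd 𝒱 𝒱)]
  have p₁_fst : p₁ ≫ L.dom.ι ≫ (fst 𝒱 𝒱).left = Ω.ι ≫ (fst 𝒱 AO).left := by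
    rw [← Category.assoc, hp₁, Category.assoc, hθ'1]
  have p₁_snd : p₁ ≫ L.dom.ι ≫ (snd 𝒱 𝒱).left = Ω.ι ≫ πA ≫ A.ι := by
    rw [← Category.assoc, hp₁, Category.assoc, hθ'2]
  have p₄_fst : p₄ ≫ L.dom.ι ≫ (fst 𝒱 𝒱).left = Ω.ι ≫ (fst 𝒱 AO).left := by
    rw [← Category.assoc, hp₄, Category.assoc, hθ1]
  have p₄_snd : p₄ ≫ L.dom.ι ≫ (snd 𝒱 𝒱).left = Ω.ι ≫ πA ≫ eρ ≫ L.mul := by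
    rw [← Category.assoc, hp₄, Category.assoc, hθ2]
  have hglue' : eρ ≫ L.mul ≫ i₁.left = A.ι ≫ i₂.left := by simpa only [Category.assoc] using hglue
  -- associativity `(x b) s = x (b s)` on `Ω`
  have c₁ : LawData.Computes 𝒱 L.dom L.mul p₁ (Ω.ι ≫ (fst 𝒱 AO).left) (Ω.ι ≫ πA ≫ A.ι)
      (p₁ ≫ L.mul) := ⟨p₁_fst, p₁_snd, rfl⟩
  have c₂ : LawData.Computes 𝒱 L.dom L.mul (Ω.ι ≫ πA ≫ eρ) (Ω.ι ≫ πA ≫ A.ι)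
      ((Ω.ι ≫ πA ≫ A.ι) ≫ 𝒱.hom ≫ s) ((Ω.ι ≫ πA ≫ eρ) ≫ L.mul) :=
    ⟨by simp only [Category.assoc, eρ_fst], by simp only [Category.assoc, eρ_snd], rfl⟩
  have c₃ : LawData.Computes 𝒱 L.dom L.mul (a₃ ≫ eρ) (p₁ ≫ L.mul)
      ((Ω.ι ≫ πA ≫ A.ι) ≫ 𝒱.hom ≫ s) ((a₃ ≫ eρ) ≫ L.mul) := by
    refine ⟨by rw [Category.assoc, eρ_fst, ha₃], ?_, rfl⟩
    rw [Category.assoc, eρ_snd, reassoc_of% ha₃, reassoc_of% mul_hom, reassoc_of% p₁_snd]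
    simp only [Category.assoc]
  have c₄ : LawData.Computes 𝒱 L.dom L.mul p₄ (Ω.ι ≫ (fst 𝒱 AO).left)
      ((Ω.ι ≫ πA ≫ eρ) ≫ L.mul) (p₄ ≫ L.mul) :=
    ⟨p₄_fst, by rw [p₄_snd]; simp only [Category.assoc], rfl⟩
  have hassoc : (a₃ ≫ eρ) ≫ L.mul = p₄ ≫ L.mul := L.assoc c₁ c₂ c₃ c₄
  -- the open immersion `w : Ω → 𝒲 ×_S 𝒲` and the two lifts
  haveI : IsOpenImmersion (Ω.ι ≫ θ' ≫ (i₁ ⊗ₘ i₂).left) := inferInstance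
  have hl : (p₁ ≫ (L.dom.ι ≫ (i₁ ⊗ₘ i₂).left).isoOpensRange.hom) ≫ (L.dom.ι ≫ (i₁ ⊗ₘ i₂).left).opensRange.ι =
      Ω.ι ≫ θ' ≫ (i₁ ⊗ₘ i₂).left := by
    rw [Category.assoc, Scheme.Hom.isoOpensRange_hom_ι, ← Category.assoc, hp₁, Category.assoc]
  have hl' : (p₄ ≫ (L.dom.ι ≫ (i₁ ⊗ₘ i₁).left).isoOpensRange.hom) ≫ (L.dom.ι ≫ (i₁ ⊗ₘ i₁).left).opensRange.ι =
      Ω.ι ≫ θ' ≫ (i₁ ⊗ₘ i₂).left := by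
    rw [Category.assoc, Scheme.Hom.isoOpensRange_hom_ι]
    apply pullback.hom_ext
    · change (p₄ ≫ L.dom.ι ≫ (i₁ ⊗ₘ i₁).left) ≫ (fst 𝒲 𝒲).left = (Ω.ι ≫ θ' ≫ (i₁ ⊗ₘ i₂).left) ≫ (fst 𝒲 𝒲).left
      simp only [Category.assoc, tensorHom_left_fst_left]
      rw [reassoc_of% p₄_fst, reassoc_of% hθ'1]
    · change (p₄ ≫ L.dom.ι ≫ (i₁ ⊗ₘ i₁).left) ≫ (snd 𝒲 𝒲).left = (Ω.ι ≫ θ' ≫ (i₁ ⊗ₘ i₂).left) ≫ (snd 𝒲 𝒲).left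
      simp only [Category.assoc, tensorHom_left_snd_left]
      rw [reassoc_of% p₄_snd, reassoc_of% hθ'2, hglue']
  refine PartialMap.equiv_of_isOpenImmersion _ _ (Ω.ι ≫ θ' ≫ (i₁ ⊗ₘ i₂).left) _ hl _ hl' ?_
  change (p₁ ≫ (L.dom.ι ≫ (i₁ ⊗ₘ i₂).left).isoOpensRange.hom) ≫
      (L.dom.ι ≫ (i₁ ⊗ₘ i₂).left).isoOpensRange.inv ≫ L.mul ≫ i₂.left =
    (p₄ ≫ (L.dom.ι ≫ (i₁ ⊗ₘ i₁).left).isoOpensRange.hom) ≫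
      (L.dom.ι ≫ (i₁ ⊗ₘ i₁).left).isoOpensRange.inv ≫ L.mul ≫ i₁.left
  simp only [Category.assoc, Iso.hom_inv_id_assoc]
  rw [← reassoc_of% hassoc, hglue', reassoc_of% ha₃]

end Chart12

end Literature.AlgebraicGeometry.GroupSchemes

end
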